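import Mathlib.MeasureTheory.Integral.Prod
import Mathlib.MeasureTheory.Integral.DominatedConvergence
import Mathlib.MeasureTheory.Integral.IntervalIntegral.FundThmCalculus
import Mathlib.Analysis.Calculus.Deriv.Prod
import Mathlib.Analysis.Calculus.Deriv.Comp
import Literature.Analysis.FluidPDE.WholeSpaceIBP
import Literature.Analysis.FluidPDE.WeakSolution
import Literature.Analysis.FluidPDE.TaoEnstrophyLocalisation
import HarnessLib

/-!
# Calculus of classical Navier–Stokes solutions: joint regularity and the weak formulation

Analysis/FluidPDE support file 2/3 for the discharge of
`Literature.Analysis.FluidPDE.IsClassicalNSSolutionOn.isLerayHopfOn` (Leray 1934, §32 p. 242: "toute solution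
régulière constitue a fortiori une solution turbulente").

Let `E` be a finite-dimensional real inner product space with Lebesgue measure and let
`(u, p)` be a classical solution of the forced Navier–Stokes system on a time set `S`
(`Literature.Fluid.IsClassicalNSSolutionOn S ν f u p`: `u`, `p` jointly `C^∞` on `S × E`, momentum
equation with the one-sided time derivative `timeDerivWithin S`, `div u = 0`). This file proves:

* joint regularity: on a time set of unique differentiability, the time derivative
  `timeDerivWithin S u`, the Laplacian `Δ(u t)(x)` and the pressure gradient are again jointly
  smooth (`IsSmoothSpaceTimeOn.timeDerivWithin`, `.laplacian`, `.gradient`; the slice derivative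
  `IsSmoothSpaceTimeOn.fderiv_slice` is reused from `FluidPDE/TaoEnstrophyLocalisation`), so that the force `f` is jointly continuous on
  `[0, T] × E` through the equation (`IsClassicalNSSolutionOn.continuousOn_force`);
* **classical solutions are weak solutions**: `IsClassicalNSSolutionOn.isWeakNSSolutionOn_holds`,
  the discharge of the named fact `Literature.Analysis.FluidPDE.IsClassicalNSSolutionOn.isWeakNSSolutionOn`
  (Leray 1934, §III derivation of (17); slice-wise integration by parts from
  `WholeSpaceIBP`, then the fundamental theorem of calculus in time and Fubini).

The energy equality (Leray 1934, §17 (3.4)) and the assembly of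
`IsClassicalNSSolutionOn.isLerayHopfOn_holds` are in `FluidPDE/LerayHopfProofs` (file 3/3).

## References

* J. Leray, *Sur le mouvement d'un liquide visqueux emplissant l'espace*, Acta Math. 63 (1934),
  §6 (1.11), (17) p. 206, §17 (3.4) p. 220, §§31–32 pp. 240–242.
* W. S. Ożański, B. C. Pooley, *Leray's fundamental work on the Navier–Stokes equations: a
  modern review*, arXiv:1708.09787, Thm. 1.7/17 (energy equality (3.4)).
* G. P. Galdi, *An introduction to the Navier–Stokes initial-boundary value problem* (2000),
  Def. 2.1, Thm. 4.1.
-/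

noncomputable section

open MeasureTheory TopologicalSpace Set Function Filter Topology InnerProductSpace
open scoped RealInnerProductSpace ENNReal NNReal Laplacian

namespace Literature.Analysis.FluidPDE

/-! ### Joint space–time regularity -/

section SpaceTime

open scoped ContDiff

variable {X : Type*} [NormedAddCommGroup X] [NormedSpace ℝ X]
variable {F : Type*} [NormedAddCommGroup F] [NormedSpace ℝ F]
variable {S : Set ℝ} {w : ℝ → X → F} {t : ℝ}

/-- A jointly smooth field is jointly continuous on `S × X`. [folklore] -/
theorem IsSmoothSpaceTimeOn.continuousOn (h : IsSmoothSpaceTimeOn S w) :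
    ContinuousOn (uncurry w) (S ×ˢ univ) :=
  ContDiffOn.continuousOn h

/-- `S × X` is a set of unique differentiability when `S` is. [folklore] -/
theorem uniqueDiffOn_prod_univ (hS : UniqueDiffOn ℝ S) :
    UniqueDiffOn ℝ (S ×ˢ (univ : Set X)) :=
  hS.prod uniqueDiffOn_univ

/-- The joint derivative of a jointly smooth field exists within `S × X` at every point of
`S × X`. [folklore] -/
theorem IsSmoothSpaceTimeOn.hasFDerivWithinAt (h : IsSmoothSpaceTimeOn S w) (ht : t ∈ S)
    (x : X) : HasFDerivWithinAt (uncurry w) (fderivWithin ℝ (uncurry w) (S ×ˢ univ) (t, x))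
      (S ×ˢ univ) (t, x) :=
  ((h (t, x) ⟨ht, mem_univ _⟩).differentiableWithinAt (by simp)).hasFDerivWithinAt

/-- **Time derivative from the joint derivative**: for `t ∈ S`, the time line `s ↦ w s x` has
within `S` at `t` the derivative `D(uncurry w)(t, x) (1, 0)`. [folklore] -/
theorem IsSmoothSpaceTimeOn.hasDerivWithinAt_time (h : IsSmoothSpaceTimeOn S w) (ht : t ∈ S)
    (x : X) : HasDerivWithinAt (fun s => w s x)
      (fderivWithin ℝ (uncurry w) (S ×ˢ univ) (t, x) ((1 : ℝ), (0 : X))) S t := by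
  have h2 : HasDerivWithinAt (fun s : ℝ => ((s, x) : ℝ × X)) ((1 : ℝ), (0 : X)) S t :=
    (hasDerivWithinAt_id t S).prodMk (hasDerivWithinAt_const t S x)
  exact (h.hasFDerivWithinAt ht x).comp_hasDerivWithinAt t h2 fun s hs =>
    mk_mem_prod hs (mem_univ x)

/-- On a time set of unique differentiability, `timeDerivWithin S w t x = D(uncurry w)(t,x)(1,0)`
for `t ∈ S`. [folklore] -/
theorem IsSmoothSpaceTimeOn.timeDerivWithin_eq (h : IsSmoothSpaceTimeOn S w) (hS : UniqueDiffOn ℝ S)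
    (ht : t ∈ S) (x : X) : timeDerivWithin S w t x =
      fderivWithin ℝ (uncurry w) (S ×ˢ univ) (t, x) ((1 : ℝ), (0 : X)) :=
  (h.hasDerivWithinAt_time ht x).derivWithin (hS t ht)

/-- On a time set of unique differentiability, `s ↦ w s x` has derivative `timeDerivWithin S w t x`
within `S` at every `t ∈ S`. [folklore] -/
theorem IsSmoothSpaceTimeOn.hasDerivWithinAt_timeDerivWithin (h : IsSmoothSpaceTimeOn S w)
    (hS : UniqueDiffOn ℝ S) (ht : t ∈ S) (x : X) :
    HasDerivWithinAt (fun s => w s x) (timeDerivWithin S w t x) S t := by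
  rw [h.timeDerivWithin_eq hS ht x]
  exact h.hasDerivWithinAt_time ht x

/-- **The time derivative is jointly smooth** on a time set of unique differentiability. [folklore] -/
theorem IsSmoothSpaceTimeOn.timeDerivWithin (h : IsSmoothSpaceTimeOn S w) (hS : UniqueDiffOn ℝ S) :
    IsSmoothSpaceTimeOn S (timeDerivWithin S w) := by
  have hD := uniqueDiffOn_prod_univ (X := X) hS
  have hc : ContDiffOn ℝ ∞ (fun z : ℝ × X => fderivWithin ℝ (uncurry w) (S ×ˢ univ) z
      ((1 : ℝ), (0 : X))) (S ×ˢ univ) :=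
    (h.fderivWithin hD (by simp)).clm_apply contDiffOn_const
  refine hc.congr fun z hz => ?_
  obtain ⟨t, x⟩ := z
  exact h.timeDerivWithin_eq hS hz.1 x

/-- Sums of jointly smooth fields are jointly smooth. [folklore] -/
theorem IsSmoothSpaceTimeOn.add {w₁ w₂ : ℝ → X → F} (h₁ : IsSmoothSpaceTimeOn S w₁)
    (h₂ : IsSmoothSpaceTimeOn S w₂) : IsSmoothSpaceTimeOn S (fun t x => w₁ t x + w₂ t x) :=
  ContDiffOn.add h₁ h₂

/-- Differences of jointly smooth fields are jointly smooth. [folklore] -/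
theorem IsSmoothSpaceTimeOn.sub {w₁ w₂ : ℝ → X → F} (h₁ : IsSmoothSpaceTimeOn S w₁)
    (h₂ : IsSmoothSpaceTimeOn S w₂) : IsSmoothSpaceTimeOn S (fun t x => w₁ t x - w₂ t x) :=
  ContDiffOn.sub h₁ h₂

/-- Scalar multiples of jointly smooth fields are jointly smooth. [folklore] -/
theorem IsSmoothSpaceTimeOn.const_smul (h : IsSmoothSpaceTimeOn S w) (c : ℝ) :
    IsSmoothSpaceTimeOn S (fun t x => c • w t x) :=
  ContDiffOn.const_smul c h

/-- Applying a jointly smooth operator field to a jointly smooth vector field is jointly smooth. [folklore] -/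
theorem IsSmoothSpaceTimeOn.clm_apply {G : Type*} [NormedAddCommGroup G] [NormedSpace ℝ G]
    {L : ℝ → X → F →L[ℝ] G} {v : ℝ → X → F} (hL : IsSmoothSpaceTimeOn S L)
    (hv : IsSmoothSpaceTimeOn S v) : IsSmoothSpaceTimeOn S (fun t x => L t x (v t x)) :=
  ContDiffOn.clm_apply hL hv

end SpaceTime

section SpaceTimeInner

variable {E : Type*} [NormedAddCommGroup E] [InnerProductSpace ℝ E] [FiniteDimensional ℝ E]
variable {F' : Type*} [NormedAddCommGroup F'] [InnerProductSpace ℝ F']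
variable {S : Set ℝ}

omit [FiniteDimensional ℝ E] in
/-- The convective derivative `(u·∇)v` of jointly smooth fields is jointly smooth (on a time set
of unique differentiability). [folklore] -/
theorem IsSmoothSpaceTimeOn.convect {u : ℝ → E → E} {v : ℝ → E → F'} (hu : IsSmoothSpaceTimeOn S u)
    (hv : IsSmoothSpaceTimeOn S v) (hS : UniqueDiffOn ℝ S) :
    IsSmoothSpaceTimeOn S (fun t x => convect (u t) (v t) x) :=
  (hv.fderiv_slice hS).clm_apply hu

/-- The slice Laplacian `Δ(v t)(x)` of a jointly smooth field is jointly smooth (on a time set of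
unique differentiability): `Δ = Σᵢ ∂ᵢ∂ᵢ` and each `∂ᵢ` preserves joint smoothness. [folklore] -/
theorem IsSmoothSpaceTimeOn.laplacian {v : ℝ → E → F'} (hv : IsSmoothSpaceTimeOn S v)
    (hS : UniqueDiffOn ℝ S) : IsSmoothSpaceTimeOn S (fun t x => (Δ (v t)) x) := by
  set b := stdOrthonormalBasis ℝ E
  have h1 : ∀ i, IsSmoothSpaceTimeOn S (fun t x => fderiv ℝ (v t) x (b i)) := fun i =>
    (hv.fderiv_slice hS).clm_apply (v := fun _ _ => b i) contDiffOn_const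
  have h2 : ∀ i, IsSmoothSpaceTimeOn S
      (fun t x => fderiv ℝ (fun y => fderiv ℝ (v t) y (b i)) x (b i)) := fun i =>
    ((h1 i).fderiv_slice hS).clm_apply (v := fun _ _ => b i) contDiffOn_const
  have h3 : IsSmoothSpaceTimeOn S
      (fun t x => ∑ i, fderiv ℝ (fun y => fderiv ℝ (v t) y (b i)) x (b i)) :=
    ContDiffOn.sum fun i _ => h2 i
  refine ContDiffOn.congr h3 fun z hz => ?_
  obtain ⟨t, x⟩ := z
  exact laplacian_eq_sum_fderiv_fderiv b (contDiff_infty.1 (hv.contDiff_slice hz.1) 2) x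

/-- The slice gradient `∇(p t)(x)` of a jointly smooth scalar field is jointly smooth (on a time
set of unique differentiability). [folklore] -/
theorem IsSmoothSpaceTimeOn.gradient {p : ℝ → E → ℝ} (hp : IsSmoothSpaceTimeOn S p)
    (hS : UniqueDiffOn ℝ S) : IsSmoothSpaceTimeOn S (fun t x => gradient (p t) x) :=
  (InnerProductSpace.toDual ℝ E).symm.contDiff.comp_contDiffOn (hp.fderiv_slice hS)

variable {ν : ℝ} {f u : ℝ → E → E} {p : ℝ → E → ℝ}

/-- **The force is jointly continuous.** For a classical solution on a time set `S` of unique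
differentiability, `f = ∂ₜu + (u·∇)u − νΔu + ∇p` on `S × E` is jointly smooth, hence jointly
continuous, there (Leray 1934, (3.1): the equation determines the force). [folklore] -/
theorem IsClassicalNSSolutionOn.isSmoothSpaceTimeOn_force (h : IsClassicalNSSolutionOn S ν f u p)
    (hS : UniqueDiffOn ℝ S) : IsSmoothSpaceTimeOn S f := by
  have hsm : IsSmoothSpaceTimeOn S (fun t x => timeDerivWithin S u t x +
      convect (u t) (u t) x - ν • (Δ (u t)) x + gradient (p t) x) :=
    (((h.smooth_velocity.timeDerivWithin hS).add
      (h.smooth_velocity.convect h.smooth_velocity hS)).sub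
      ((h.smooth_velocity.laplacian hS).const_smul ν)).add (h.smooth_pressure.gradient hS)
  refine ContDiffOn.congr hsm fun z hz => ?_
  obtain ⟨t, x⟩ := z
  have := h.momentum t hz.1 x
  change f t x = timeDerivWithin S u t x + convect (u t) (u t) x - ν • (Δ (u t)) x + gradient (p t) x
  rw [eq_comm, ← sub_eq_zero] at this
  rw [← sub_eq_zero, ← this]
  abel

/-- The force of a classical solution is jointly continuous on `S × E` (`S` of unique
differentiability). [folklore] -/
theorem IsClassicalNSSolutionOn.continuousOn_force (h : IsClassicalNSSolutionOn S ν f u p)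
    (hS : UniqueDiffOn ℝ S) : ContinuousOn (uncurry f) (S ×ˢ univ) :=
  (h.isSmoothSpaceTimeOn_force hS).continuousOn

/-- Each time slice `f t`, `t ∈ S`, of the force of a classical solution is continuous (`S` of
unique differentiability). [folklore] -/
theorem IsClassicalNSSolutionOn.continuous_force_slice (h : IsClassicalNSSolutionOn S ν f u p)
    (hS : UniqueDiffOn ℝ S) {t : ℝ} (ht : t ∈ S) : Continuous (f t) :=
  ((h.isSmoothSpaceTimeOn_force hS).contDiff_slice ht).continuous

end SpaceTimeInner

/-! ### Space–time integrability of continuous integrands with compact `x`-support -/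

section Measure

variable {E : Type*} [NormedAddCommGroup E] [InnerProductSpace ℝ E] [FiniteDimensional ℝ E]
  [MeasurableSpace E] [BorelSpace E]
variable {F : Type*} [NormedAddCommGroup F] [NormedSpace ℝ F]

omit [NormedSpace ℝ F] in
/-- **Integrability on `(a, b) × E`** of a function continuous on `[a, b] × E` and vanishing for
`x` outside a compact set `K` (continuous on the compact `[a, b] × K`, zero elsewhere). [folklore] -/
theorem integrable_prod_of_continuousOn {G : ℝ × E → F} {a b : ℝ} {K : Set E} (hK : IsCompact K)
    (hG : ContinuousOn G (Icc a b ×ˢ univ)) (hGK : ∀ t ∈ Icc a b, ∀ x ∉ K, G (t, x) = 0) :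
    Integrable G (((volume : Measure ℝ).restrict (Ioo a b)).prod (volume : Measure E)) := by
  rw [Measure.restrict_prod_eq_prod_univ]
  have h1 : IntegrableOn G (Icc a b ×ˢ K) ((volume : Measure ℝ).prod (volume : Measure E)) :=
    (hG.mono (prod_mono Subset.rfl (subset_univ _))).integrableOn_compact (isCompact_Icc.prod hK)
  refine (h1.mono_set (prod_mono Ioo_subset_Icc_self Subset.rfl)).of_forall_sdiff_eq_zero
    (measurableSet_Ioo.prod MeasurableSet.univ) fun z hz => ?_
  obtain ⟨t, x⟩ := z
  simp only [Set.mem_sdiff, mem_prod, mem_univ, and_true, not_and] at hz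
  exact hGK t (Ioo_subset_Icc_self hz.1) x (hz.2 hz.1)

omit [NormedSpace ℝ F] in
/-- A function continuous on `[a, b] × E` is a.e. strongly measurable for `dt|_(a,b) ⊗ dx`. [folklore] -/
theorem aestronglyMeasurable_prod_of_continuousOn {G : ℝ × E → F} {a b : ℝ}
    (hG : ContinuousOn G (Icc a b ×ˢ univ)) :
    AEStronglyMeasurable G (((volume : Measure ℝ).restrict (Ioo a b)).prod (volume : Measure E)) := by
  rw [Measure.restrict_prod_eq_prod_univ]
  exact (hG.mono (prod_mono Ioo_subset_Icc_self Subset.rfl)).aestronglyMeasurable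
    (measurableSet_Ioo.prod MeasurableSet.univ)

omit [NormedSpace ℝ F] in
/-- **Integrability on `(a, b) × E` from a finite iterated `lintegral`**: a function continuous on
`[a, b] × E` with `∫_(a,b) ∫ ‖G‖ < ∞` is integrable for `dt|_(a,b) ⊗ dx` (Tonelli). [folklore] -/
theorem integrable_prod_of_continuousOn_of_lintegral {G : ℝ × E → F} {a b : ℝ}
    (hG : ContinuousOn G (Icc a b ×ˢ univ))
    (hfin : ∫⁻ t in Ioo a b, ∫⁻ x, ‖G (t, x)‖ₑ < ∞) :
    Integrable G (((volume : Measure ℝ).restrict (Ioo a b)).prod (volume : Measure E)) := by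
  have hm := aestronglyMeasurable_prod_of_continuousOn hG
  refine ⟨hm, ?_⟩
  rw [HasFiniteIntegral, lintegral_prod _ hm.enorm]
  exact hfin

/-- Iterated `lintegral`s over a smaller time interval are smaller. [folklore] -/
theorem lintegral_Ioo_mono {g : ℝ → ℝ≥0∞} {a b a' b' : ℝ} (ha : a ≤ a') (hb : b' ≤ b) :
    ∫⁻ t in Ioo a' b', g t ≤ ∫⁻ t in Ioo a b, g t :=
  lintegral_mono_set (Ioo_subset_Ioo ha hb)

/-- **Norm of an iterated integral bounded by the iterated `lintegral` of the norm.** [folklore] -/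
theorem norm_integral_integral_le_of_lintegral_le {G : ℝ × E → F} {a b : ℝ} {B : ℝ≥0∞}
    (hB : B ≠ ∞) (hle : ∫⁻ t in Ioo a b, ∫⁻ x, ‖G (t, x)‖ₑ ≤ B) :
    ‖∫ t in Ioo a b, ∫ x, G (t, x)‖ ≤ B.toReal := by
  refine (norm_integral_le_lintegral_norm _).trans (ENNReal.toReal_mono hB (le_trans ?_ hle))
  refine lintegral_mono fun t => ?_
  rw [ofReal_norm]
  exact enorm_integral_le_lintegral_enorm _

end Measure

/-! ### Test fields: compact `x`-support and the time derivative -/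

section TestField

variable {X : Type*} {E : Type*} [NormedAddCommGroup E] [NormedSpace ℝ E]
variable {F : Type*} [NormedAddCommGroup F] [NormedSpace ℝ F]

/-- The `x`-shadow `K = snd '' tsupport ψ` of a space–time test field is compact and contains
the support of every time slice. [folklore] -/
theorem IsSpaceTimeTestOn.exists_compact_slice_subset {Q : Opens (ℝ × E)} {ψ : ℝ → E → F}
    (hψ : IsSpaceTimeTestOn Q ψ) :
    ∃ K : Set E, IsCompact K ∧ ∀ t, tsupport (ψ t) ⊆ K := by
  refine ⟨Prod.snd '' tsupport (uncurry ψ), hψ.hasCompactSupport.image continuous_snd, fun t => ?_⟩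
  refine closure_minimal (fun x hx => ⟨(t, x), subset_tsupport _ hx, rfl⟩)
    (hψ.hasCompactSupport.image continuous_snd).isClosed

/-- Time slices of a space–time test field have compact support. [folklore] -/
theorem IsSpaceTimeTestOn.hasCompactSupport_slice {Q : Opens (ℝ × E)} {ψ : ℝ → E → F}
    (hψ : IsSpaceTimeTestOn Q ψ) (t : ℝ) : HasCompactSupport (ψ t) := by
  obtain ⟨K, hK, hKt⟩ := hψ.exists_compact_slice_subset
  exact hK.of_isClosed_subset (isClosed_tsupport _) (hKt t)

/-- A space–time test field is jointly smooth on every time set. [folklore] -/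
theorem IsSpaceTimeTestOn.isSmoothSpaceTimeOn {Q : Opens (ℝ × E)} {ψ : ℝ → E → F}
    (hψ : IsSpaceTimeTestOn Q ψ) (S : Set ℝ) : IsSmoothSpaceTimeOn S ψ :=
  hψ.contDiff.contDiffOn

/-- The two-sided time derivative of a test field is the one-sided one within `univ`. [folklore] -/
theorem timeDeriv_eq_timeDerivWithin_univ (ψ : ℝ → X → F) :
    timeDeriv ψ = timeDerivWithin univ ψ := by
  ext t x
  simp [timeDeriv, timeDerivWithin, derivWithin_univ]

/-- The time derivative of a space–time test field is jointly smooth (hence jointly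
continuous). [folklore] -/
theorem IsSpaceTimeTestOn.isSmoothSpaceTimeOn_timeDeriv {Q : Opens (ℝ × E)} {ψ : ℝ → E → F}
    (hψ : IsSpaceTimeTestOn Q ψ) : IsSmoothSpaceTimeOn univ (timeDeriv ψ) := by
  rw [timeDeriv_eq_timeDerivWithin_univ]
  exact (hψ.isSmoothSpaceTimeOn univ).timeDerivWithin uniqueDiffOn_univ

/-- The time derivative of a space–time test field is jointly continuous. [folklore] -/
theorem IsSpaceTimeTestOn.continuous_timeDeriv {Q : Opens (ℝ × E)} {ψ : ℝ → E → F}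
    (hψ : IsSpaceTimeTestOn Q ψ) : Continuous (uncurry (timeDeriv ψ)) := by
  have := hψ.isSmoothSpaceTimeOn_timeDeriv.continuousOn
  rwa [univ_prod_univ, continuousOn_univ] at this

/-- Each time line `s ↦ ψ s x` of a space–time test field is differentiable with derivative
`timeDeriv ψ t x`. [folklore] -/
theorem IsSpaceTimeTestOn.hasDerivAt_time {Q : Opens (ℝ × E)} {ψ : ℝ → E → F}
    (hψ : IsSpaceTimeTestOn Q ψ) (t : ℝ) (x : E) :
    HasDerivAt (fun s => ψ s x) (timeDeriv ψ t x) t := by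
  have hd : Differentiable ℝ fun s : ℝ => ψ s x :=
    (hψ.contDiff.differentiable (by simp)).comp (differentiable_id.prodMk (differentiable_const x))
  exact (hd t).hasDerivAt

/-- The time derivative of a test field vanishes where all slices vanish. [folklore] -/
theorem timeDeriv_eq_zero_of_forall {ψ : ℝ → X → F} {x : X} (hx : ∀ s, ψ s x = 0) (t : ℝ) :
    timeDeriv ψ t x = 0 := by
  simp [timeDeriv, funext hx]

end TestField

/-! ### Classical solutions are weak solutions -/

section Weak

variable {E : Type*} [NormedAddCommGroup E] [InnerProductSpace ℝ E] [FiniteDimensional ℝ E]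
  [MeasurableSpace E] [BorelSpace E]
variable {F' : Type*} [NormedAddCommGroup F'] [InnerProductSpace ℝ F']

/-- `x ↦ ⟪v x, w x⟫` is integrable when both factors are continuous and the right one has compact
support. [folklore] -/
theorem integrable_inner_of_hasCompactSupport_right {v w : E → F'} (hv : Continuous v)
    (hw : Continuous w) (hc : HasCompactSupport w) :
    Integrable (fun x => ⟪v x, w x⟫) (volume : Measure E) :=
  (hv.inner hw).integrable_of_hasCompactSupport (hc.mono fun x hx => by contrapose! hx; simp_all)

/-- `x ↦ ⟪v x, w x⟫` is integrable when both factors are continuous and the left one has compact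
support. [folklore] -/
theorem integrable_inner_of_hasCompactSupport_left {v w : E → F'} (hv : Continuous v)
    (hw : Continuous w) (hc : HasCompactSupport v) :
    Integrable (fun x => ⟪v x, w x⟫) (volume : Measure E) :=
  (hv.inner hw).integrable_of_hasCompactSupport (hc.mono fun x hx => by contrapose! hx; simp_all)

/-- **Symmetry of the Laplacian against compactly supported fields**: `∫ ⟪Δv, w⟫ = ∫ ⟪v, Δw⟫`
for `v ∈ C²`, `w ∈ C²_c` (Green's second identity without boundary; twice
`integral_inner_laplacian_add_eq_zero`; Leray 1934, §6 (1.11)). [cite: Leray1934, §6 (1.11) p. 203] -/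
theorem integral_inner_laplacian_comm {v w : E → F'} (hv : ContDiff ℝ 2 v) (hw : ContDiff ℝ 2 w)
    (hc : HasCompactSupport w) :
    ∫ x, ⟪(Δ v) x, w x⟫ = ∫ x, ⟪v x, (Δ w) x⟫ := by
  set b := stdOrthonormalBasis ℝ E
  have h1 := integral_inner_laplacian_add_eq_zero b hv (hw.of_le one_le_two) (Or.inr hc)
  have h2 := integral_inner_laplacian_add_eq_zero b hw (hv.of_le one_le_two) (Or.inl hc)
  have h3 : ∑ i, ∫ x, ⟪fderiv ℝ v x (b i), fderiv ℝ w x (b i)⟫ =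
      ∑ i, ∫ x, ⟪fderiv ℝ w x (b i), fderiv ℝ v x (b i)⟫ :=
    Finset.sum_congr rfl fun i _ => integral_congr_ae (Eventually.of_forall fun x =>
      real_inner_comm _ _)
  have h4 : ∫ x, ⟪v x, (Δ w) x⟫ = ∫ x, ⟪(Δ w) x, v x⟫ :=
    integral_congr_ae (Eventually.of_forall fun x => real_inner_comm _ _)
  linarith

variable {T ν : ℝ} {f u : ℝ → E → E} {p : ℝ → E → ℝ}

/-- **The slice identity behind the weak formulation.** For a classical solution on a time set
`S` of unique differentiability, `t ∈ S`, and a smooth compactly supported divergence-free field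
`ψt`, pairing the momentum equation with `ψt` and integrating by parts in `x` gives
`∫ ⟪∂ₜu(t), ψt⟫ = ∫ ⟪u, (u·∇)ψt⟫ + ν ∫ ⟪u, Δψt⟫ + ∫ ⟪f, ψt⟫`
(Leray 1934, §III, derivation of (17) p. 206: the pressure drops out and the nonlinear and
viscous terms are moved onto the test field). [cite: Leray1934, (17) p. 206] -/
theorem IsClassicalNSSolutionOn.integral_inner_timeDerivWithin_test {S : Set ℝ}
    (h : IsClassicalNSSolutionOn S ν f u p) (hS : UniqueDiffOn ℝ S) {t : ℝ} (ht : t ∈ S)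
    {ψt : E → E} (hψ : ContDiff ℝ 2 ψt) (hc : HasCompactSupport ψt) (hdiv : VectorCalculus.IsDivFree ψt) :
    ∫ x, ⟪timeDerivWithin S u t x, ψt x⟫ =
      ∫ x, (⟪u t x, convect (u t) ψt x⟫ + ν * ⟪u t x, (Δ ψt) x⟫ + ⟪f t x, ψt x⟫) := by
  -- regularity of the slices
  have hu2 : ContDiff ℝ 2 (u t) := contDiff_infty.1 (h.contDiff_velocity ht) 2
  have hu1 : ContDiff ℝ 1 (u t) := hu2.of_le one_le_two
  have hp1 : ContDiff ℝ 1 (p t) := contDiff_infty.1 (h.contDiff_pressure ht) 1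
  have hψ1 : ContDiff ℝ 1 ψt := hψ.of_le one_le_two
  have huc : Continuous (u t) := hu1.continuous
  have hψc : Continuous ψt := hψ1.continuous
  have hdtc : Continuous (timeDerivWithin S u t) :=
    ((h.smooth_velocity.timeDerivWithin hS).contDiff_slice ht).continuous
  -- the force through the equation
  have hf_eq : ∀ x, f t x = timeDerivWithin S u t x + convect (u t) (u t) x - ν • (Δ (u t)) x +
      gradient (p t) x := fun x => by
    have := h.momentum t ht x
    rw [eq_comm, ← sub_eq_zero] at this
    rw [← sub_eq_zero, ← this]
    abel
  have hfc : Continuous (f t) := h.continuous_force_slice hS ht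
  -- integrability of every pairing with `ψt`
  have iT := integrable_inner_of_hasCompactSupport_right hdtc hψc hc
  have iC : Integrable (fun x => ⟪convect (u t) (u t) x, ψt x⟫) (volume : Measure E) :=
    integrable_inner_of_hasCompactSupport_right
      ((hu1.continuous_fderiv one_ne_zero).clm_apply huc) hψc hc
  have iL := integrable_inner_of_hasCompactSupport_right (continuous_laplacian hu2) hψc hc
  have iP := integrable_inner_of_hasCompactSupport_right (continuous_gradient_of_contDiff hp1)
    hψc hc
  have iF := integrable_inner_of_hasCompactSupport_right hfc hψc hc
  have iC' : Integrable (fun x => ⟪u t x, convect (u t) ψt x⟫) (volume : Measure E) :=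
    integrable_inner_of_hasCompactSupport_right huc
      ((hψ1.continuous_fderiv one_ne_zero).clm_apply huc)
      ((hc.fderiv (𝕜 := ℝ)).mono fun x hx => by
        contrapose! hx; simp only [mem_support, not_not] at hx; simp [convect, hx])
  have iL' : Integrable (fun x => ⟪u t x, (Δ ψt) x⟫) (volume : Measure E) :=
    integrable_inner_of_hasCompactSupport_right huc (continuous_laplacian hψ)
      (hc.mono' fun x hx => by
        contrapose! hx; simp [laplacian_eq_zero_of_notMem_tsupport hx])
  -- integration by parts, term by term
  have eC : ∫ x, ⟪convect (u t) (u t) x, ψt x⟫ = -∫ x, ⟪u t x, convect (u t) ψt x⟫ := by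
    have h0 := integral_inner_convect_add_eq_zero hu1 hu1 hψ1 hc
    have hz : ∫ x, VectorCalculus.divergence (u t) x * ⟪u t x, ψt x⟫ = 0 := by
      simp [h.divFree t ht _]
    linarith
  have eL : ∫ x, ⟪(Δ (u t)) x, ψt x⟫ = ∫ x, ⟪u t x, (Δ ψt) x⟫ :=
    integral_inner_laplacian_comm hu2 hψ hc
  have eP : ∫ x, ⟪gradient (p t) x, ψt x⟫ = 0 := by
    rw [integral_inner_gradient_eq_neg_integral_mul_divergence hp1 hψ1 hc]
    simp [hdiv _]
  -- assemble
  have key : ∀ x, ⟪timeDerivWithin S u t x, ψt x⟫ = ⟪f t x, ψt x⟫ -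
      ⟪convect (u t) (u t) x, ψt x⟫ + ν * ⟪(Δ (u t)) x, ψt x⟫ - ⟪gradient (p t) x, ψt x⟫ := by
    intro x
    rw [hf_eq x]
    simp only [inner_add_left, inner_sub_left, inner_smul_left, RCLike.conj_to_real]
    ring
  have j1 : Integrable (fun x => ⟪f t x, ψt x⟫ - ⟪convect (u t) (u t) x, ψt x⟫)
      (volume : Measure E) := iF.sub iC
  have j2 : Integrable (fun x => ν * ⟪(Δ (u t)) x, ψt x⟫) (volume : Measure E) := iL.const_mul ν
  have j3 : Integrable (fun x => ⟪f t x, ψt x⟫ - ⟪convect (u t) (u t) x, ψt x⟫ +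
      ν * ⟪(Δ (u t)) x, ψt x⟫) (volume : Measure E) := j1.add j2
  have j4 : Integrable (fun x => ν * ⟪u t x, (Δ ψt) x⟫) (volume : Measure E) := iL'.const_mul ν
  have j5 : Integrable (fun x => ⟪u t x, convect (u t) ψt x⟫ + ν * ⟪u t x, (Δ ψt) x⟫)
      (volume : Measure E) := iC'.add j4
  rw [integral_congr_ae (Eventually.of_forall key), integral_sub j3 iP, integral_add j1 j2,
    integral_sub iF iC, integral_const_mul, integral_add j5 iF, integral_add iC' j4,
    integral_const_mul, eC, eL, eP]
  ring

/-- **Classical solutions are weak solutions**: discharge of the named fact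
`Literature.Analysis.FluidPDE.IsClassicalNSSolutionOn.isWeakNSSolutionOn`. A classical solution on a time set
`S ⊇ [0, T]` is a weak (pressure-free) solution on `[0, T)` with datum `u 0`: measurability and
local square integrability from joint continuity on `[0, T] × E`; weak divergence-freeness from
`IsDivFree.isWeaklyDivFree`; the weak identity from the slice identity
`integral_inner_timeDerivWithin_test`, the fundamental theorem of calculus on each time line
`t ↦ ⟪u(t, x), ψ(t, x)⟫` (boundary term `-⟪u(0), ψ(0)⟫`, since `ψ(T) = 0`) and Fubini
(Leray 1934, §III, derivation of (17) p. 206; Temam, Ch. III §1.1). For `T ≤ 0` everything is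
vacuous (`(0, T) = ∅`, `ψ(0) = 0`). [cite: Leray1934, (17) p. 206] -/
theorem IsClassicalNSSolutionOn.isWeakNSSolutionOn_holds :
    IsClassicalNSSolutionOn.isWeakNSSolutionOn (E := E) (T := T) (ν := ν) (f := f) (u := u)
      (p := p) := by
  intro S h hS
  rcases le_or_gt T 0 with hT | hT
  · -- degenerate interval
    have hI : Ioo 0 T = ∅ := Ioo_eq_empty_of_le hT
    refine ⟨?_, ?_, ?_, ?_⟩
    · rw [hI, empty_prod, Measure.restrict_empty]
      exact aestronglyMeasurable_zero_measure _
    · intro K _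
      simp [hI]
    · simp [hI]
    · intro ψ hψ _
      have h0 : ∀ x, ψ 0 x = 0 := fun x => hψ.apply_eq_zero (by simp [hT])
      simp [hI, h0]
  -- genuine interval: restrict to `[0, T]`
  set S₀ : Set ℝ := Icc 0 T with hS₀
  have hU : UniqueDiffOn ℝ S₀ := uniqueDiffOn_Icc hT
  have h₀ : IsClassicalNSSolutionOn S₀ ν f u p := h.mono hS hU
  have hu_cont : ContinuousOn (uncurry u) (S₀ ×ˢ univ) := h₀.smooth_velocity.continuousOn
  have hdt_cont : ContinuousOn (uncurry (timeDerivWithin S₀ u)) (S₀ ×ˢ univ) :=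
    (h₀.smooth_velocity.timeDerivWithin hU).continuousOn
  refine ⟨?_, ?_, ?_, ?_⟩
  · -- measurability on `(0, T) × E`
    exact (hu_cont.mono (prod_mono Ioo_subset_Icc_self Subset.rfl)).aestronglyMeasurable
      (measurableSet_Ioo.prod MeasurableSet.univ)
  · -- local square integrability up to the time boundary
    intro K hK
    obtain ⟨C, hC⟩ := (isCompact_Icc.prod hK).exists_bound_of_continuousOn
      (hu_cont.mono (prod_mono Subset.rfl (subset_univ K)))
    have hle : ∀ z ∈ Ioo 0 T ×ˢ K, ‖uncurry u z‖ₑ ^ 2 ≤ ENNReal.ofReal C ^ 2 := fun z hz => by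
      gcongr
      rw [← ofReal_norm]
      exact ENNReal.ofReal_le_ofReal (hC z ⟨Ioo_subset_Icc_self hz.1, hz.2⟩)
    refine lt_of_le_of_lt (setLIntegral_mono' (measurableSet_Ioo.prod hK.measurableSet) hle) ?_
    rw [setLIntegral_const]
    refine ENNReal.mul_lt_top (ENNReal.pow_lt_top ENNReal.ofReal_lt_top) ?_
    rw [Measure.volume_eq_prod, Measure.prod_prod]
    exact ENNReal.mul_lt_top measure_Ioo_lt_top hK.measure_lt_top
  · -- weak divergence-freeness slice-wise
    exact (ae_restrict_iff' measurableSet_Ioo).2 (Eventually.of_forall fun t ht =>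
      VectorCalculus.IsDivFree.isWeaklyDivFree_holds (h₀.divFree t (Ioo_subset_Icc_self ht))
        (contDiff_infty.1 (h₀.contDiff_velocity (Ioo_subset_Icc_self ht)) 1))
  · -- the weak identity
    intro ψ hψ hdiv
    obtain ⟨K, hK, hKt⟩ := hψ.exists_compact_slice_subset
    have hψ0 : ∀ t, ∀ x ∉ K, ψ t x = 0 := fun t x hx =>
      image_eq_zero_of_notMem_tsupport fun h' => hx (hKt t h')
    have hψT : ∀ x, ψ T x = 0 := fun x => hψ.apply_eq_zero (by simp)
    -- the space–time integrand after the slice identity: `∂ₜ ⟪u, ψ⟫`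
    set D : ℝ × E → ℝ := fun z => ⟪u z.1 z.2, timeDeriv ψ z.1 z.2⟫ +
      ⟪timeDerivWithin S₀ u z.1 z.2, ψ z.1 z.2⟫ with hD
    have hDcont : ContinuousOn D (Icc 0 T ×ˢ univ) := by
      refine ContinuousOn.add (ContinuousOn.inner hu_cont
        hψ.continuous_timeDeriv.continuousOn) (ContinuousOn.inner hdt_cont ?_)
      exact (hψ.contDiff.continuous).continuousOn
    have hDK : ∀ t ∈ Icc 0 T, ∀ x ∉ K, D (t, x) = 0 := fun t _ x hx => by
      simp only [hD]
      rw [hψ0 t x hx, timeDeriv_eq_zero_of_forall (fun s => hψ0 s x hx)]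
      simp
    have hDint := integrable_prod_of_continuousOn hK hDcont hDK
    -- slice identity for every `t ∈ [0, T]`
    have hslice : ∀ t ∈ Ioo 0 T, ∫ x, (⟪u t x, timeDeriv ψ t x⟫ + ⟪u t x, convect (u t) (ψ t) x⟫ +
        ν * ⟪u t x, (Δ (ψ t)) x⟫ + ⟪f t x, ψ t x⟫) = ∫ x, D (t, x) := by
      intro t ht
      have ht' : t ∈ S₀ := Ioo_subset_Icc_self ht
      have hψ2 : ContDiff ℝ 2 (ψ t) := contDiff_infty.1 (hψ.contDiff_slice t) 2
      have key := h₀.integral_inner_timeDerivWithin_test hU ht' hψ2 (hψ.hasCompactSupport_slice t)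
        (hdiv t)
      have huc : Continuous (u t) := (h₀.contDiff_velocity ht').continuous
      have i1 : Integrable (fun x => ⟪u t x, timeDeriv ψ t x⟫) (volume : Measure E) :=
        integrable_inner_of_hasCompactSupport_right huc
          (hψ.continuous_timeDeriv.comp (Continuous.prodMk_right t))
          (HasCompactSupport.intro hK fun x hx => timeDeriv_eq_zero_of_forall
            (fun s => hψ0 s x hx) t)
      have i2 : Integrable (fun x => ⟪timeDerivWithin S₀ u t x, ψ t x⟫) (volume : Measure E) :=
        integrable_inner_of_hasCompactSupport_right
          (((h₀.smooth_velocity.timeDerivWithin hU).contDiff_slice ht').continuous)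
          (hψ.contDiff_slice t).continuous (hψ.hasCompactSupport_slice t)
      have hψ1 : ContDiff ℝ 1 (ψ t) := hψ2.of_le one_le_two
      have iC' : Integrable (fun x => ⟪u t x, convect (u t) (ψ t) x⟫) (volume : Measure E) :=
        integrable_inner_of_hasCompactSupport_right huc
          ((hψ1.continuous_fderiv one_ne_zero).clm_apply huc)
          (((hψ.hasCompactSupport_slice t).fderiv (𝕜 := ℝ)).mono fun x hx => by
            contrapose! hx; simp only [mem_support, not_not] at hx; simp [convect, hx])
      have iL' : Integrable (fun x => ν * ⟪u t x, (Δ (ψ t)) x⟫) (volume : Measure E) :=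
        (integrable_inner_of_hasCompactSupport_right huc (continuous_laplacian hψ2)
          ((hψ.hasCompactSupport_slice t).mono' fun x hx => by
            contrapose! hx; simp [laplacian_eq_zero_of_notMem_tsupport hx])).const_mul ν
      have iF : Integrable (fun x => ⟪f t x, ψ t x⟫) (volume : Measure E) :=
        integrable_inner_of_hasCompactSupport_right (h₀.continuous_force_slice hU ht')
          (hψ.contDiff_slice t).continuous (hψ.hasCompactSupport_slice t)
      calc ∫ x, (⟪u t x, timeDeriv ψ t x⟫ + ⟪u t x, convect (u t) (ψ t) x⟫ +
            ν * ⟪u t x, (Δ (ψ t)) x⟫ + ⟪f t x, ψ t x⟫)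
          = ∫ x, (⟪u t x, timeDeriv ψ t x⟫ + (⟪u t x, convect (u t) (ψ t) x⟫ +
            ν * ⟪u t x, (Δ (ψ t)) x⟫ + ⟪f t x, ψ t x⟫)) :=
            integral_congr_ae (Eventually.of_forall fun x => by ring)
        _ = (∫ x, ⟪u t x, timeDeriv ψ t x⟫) + ∫ x, ⟪timeDerivWithin S₀ u t x, ψ t x⟫ := by
            have i3 : Integrable (fun x => ⟪u t x, convect (u t) (ψ t) x⟫ +
                ν * ⟪u t x, (Δ (ψ t)) x⟫ + ⟪f t x, ψ t x⟫) (volume : Measure E) :=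
              (iC'.add iL').add iF
            rw [integral_add i1 i3, key]
        _ = ∫ x, D (t, x) := (integral_add i1 i2).symm
    -- integrate the slice identity in time and swap the integrals
    have hstep : ∫ t in Ioo 0 T, ∫ x, (⟪u t x, timeDeriv ψ t x⟫ + ⟪u t x, convect (u t) (ψ t) x⟫ +
        ν * ⟪u t x, (Δ (ψ t)) x⟫ + ⟪f t x, ψ t x⟫) = ∫ x, ∫ t in Ioo 0 T, D (t, x) := by
      rw [setIntegral_congr_fun measurableSet_Ioo hslice]
      exact integral_integral_swap (f := fun t x => D (t, x)) hDint
    -- fundamental theorem of calculus on each time line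
    have hline : ∀ x, ∫ t in Ioo 0 T, D (t, x) = -⟪u 0 x, ψ 0 x⟫ := by
      intro x
      have hcont : ContinuousOn (fun t => ⟪u t x, ψ t x⟫) (Icc 0 T) := by
        refine ContinuousOn.inner ?_ ?_
        · exact hu_cont.comp (Continuous.prodMk_left x).continuousOn
            fun t ht => mk_mem_prod ht (mem_univ x)
        · exact (hψ.contDiff.continuous.comp (Continuous.prodMk_left x)).continuousOn
      have hderiv : ∀ t ∈ Ioo 0 T, HasDerivWithinAt (fun t => ⟪u t x, ψ t x⟫) (D (t, x))
          (Ioi t) t := by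
        intro t ht
        have hu' : HasDerivAt (fun s => u s x) (timeDerivWithin S₀ u t x) t :=
          (h₀.smooth_velocity.hasDerivWithinAt_timeDerivWithin hU (Ioo_subset_Icc_self ht)
            x).hasDerivAt (Icc_mem_nhds ht.1 ht.2)
        exact (hu'.inner ℝ (hψ.hasDerivAt_time t x)).hasDerivWithinAt
      have hint : IntervalIntegrable (fun t => D (t, x)) volume 0 T := by
        refine ContinuousOn.intervalIntegrable ?_
        rw [uIcc_of_le hT.le]
        exact hDcont.comp (Continuous.prodMk_left x).continuousOn
          fun t ht => mk_mem_prod ht (mem_univ x)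
      have := intervalIntegral.integral_eq_sub_of_hasDeriv_right_of_le hT.le hcont hderiv hint
      rw [intervalIntegral.integral_of_le hT.le, integral_Ioc_eq_integral_Ioo] at this
      rw [this, hψT x, inner_zero_right, zero_sub]
    rw [hstep, integral_congr_ae (Eventually.of_forall hline), integral_neg, neg_add_cancel]

end Weak

end Literature.Analysis.FluidPDE
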